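import Summits.Schanuel.Schanuel.Theorems.ZilberEacDirectionalDominance
import Mathlib.Topology.Algebra.MvPolynomial
import HarnessLib

/-!
# THEOREM L: relations along sequences escaping in a FIXED direction with convergent transversal data

Zilber's Exponential-Algebraic Closedness, case ladder (host summit Schanuel, cell `pub-schanuel`,
seat 2, gen 11).  The cell's density engines G/I/J/J′/K/K′ all need the solutions to spread over a
Zariski-dense family of DIRECTIONS (rays) or of parallel LINES with an exploding / decaying power
coordinate.  In the INVARIANT-DIRECTION regime of this generation (graph bases `x_{s+1} = g(x)` with
`g(x + z q) = g(x)` for a lattice direction `q`, e.g. `x₂ = -(x₀ - x₁)²`, the degenerate balance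
directions of O51 (b)) all solution families escape along the SAME direction `q`, the power
coordinate `w = e^{g(x)}` stays BOUNDED along each family, and what varies from family to family is
the transversal limit.  The matching elimination statement is elementary:

* `eval_cons_add_smul` — `H(w, r + y q) = Σ_k a_k(w, r) y^k`, the `a_k` being the coefficients of the
  line substitution `aeval φ_q H ∈ ℂ[W, X][Y]`; `aeval_lineShift_ne_zero` — it is nonzero iff `H` is;
* THEOREM L₀ `eventually_eval_ne_zero_of_transversal_limit` — if `w_m → w₀`, `r_m → r₀`,
  `‖y_m‖ → ∞` and the leading coefficient `a_d(w₀, r₀) ≠ 0`, then `H(w_m, r_m + y_m q) ≠ 0` for all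
  large `m` (the top power of `y` dominates);
* THEOREM L `eq_zero_of_transversal_limits` — if the set `U` of limits `(w₀, r₀)` supports no nonzero
  polynomial and every `u ∈ U` is the limit of such a family on which `H` vanishes, then `H = 0`;
* the density form `unprojectedDense_of_transversal_limits` (via THEOREM H⁽ᵏ⁾,
  `ZilberEacRelationGeneral.unprojectedDense_of_no_relation`).

HONEST FRAMING: an elimination lemma; its use is `ZilberEacInvariantDirectionDensity`; `EC(3,2)`
OPEN; nothing here bears on Schanuel's conjecture (EAC ⇏ SC).
-/

noncomputable section

open MvPolynomial Filter Topology Finset Complex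
open Literature.NumberTheory.Transcendental Literature.ModelTheory.Zilber

set_option linter.dupNamespace false

namespace Summit.Schanuel.Schanuel.Theorems

/-! ## Part A. The line substitution `X ↦ X + Y q` -/

section Shift

variable {t : ℕ}

/-- **Evaluation identity for the line substitution.**  With
`φ_q = (X₀; X₁ + q₁ Y, …, X_t + q_t Y)` (coefficients `ℂ[W = X₀, X₁..X_t]`, new variable `Y`):
`H(w, r + y q) = ((aeval φ_q H).map (eval (w, r))).eval y`. [folklore] -/
theorem eval_cons_add_smul (H : MvPolynomial (Fin (t + 1)) ℂ) (q : Fin t → ℂ) (w : ℂ)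
    (r : Fin t → ℂ) (y : ℂ) :
    eval (Fin.cons w (r + y • q) : Fin (t + 1) → ℂ) H =
      ((aeval (Fin.cons (Polynomial.C (X 0))
          (fun i => Polynomial.C (X i.succ) + Polynomial.C (C (q i)) * Polynomial.X) :
          Fin (t + 1) → Polynomial (MvPolynomial (Fin (t + 1)) ℂ)) H).map
        (eval (Fin.cons w r : Fin (t + 1) → ℂ))).eval y := by
  induction H using MvPolynomial.induction_on with
  | C a =>
      rw [aeval_C, Polynomial.algebraMap_apply, MvPolynomial.algebraMap_eq, Polynomial.map_C,
        Polynomial.eval_C, eval_C, eval_C]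
  | add p₁ p₂ hp₁ hp₂ => rw [map_add, map_add, Polynomial.map_add, Polynomial.eval_add, hp₁, hp₂]
  | mul_X p i hp =>
      rw [map_mul, map_mul, Polynomial.map_mul, Polynomial.eval_mul, hp, eval_X, aeval_X]
      congr 1
      refine Fin.cases ?_ (fun j => ?_) i
      · simp
      · simp only [Fin.cons_succ, Pi.add_apply, Pi.smul_apply, smul_eq_mul, Polynomial.map_add,
          Polynomial.map_mul, Polynomial.map_C, eval_X, Fin.cons_succ, eval_C, Polynomial.map_X,
          Polynomial.eval_add, Polynomial.eval_C, Polynomial.eval_mul, Polynomial.eval_X]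
        ring

/-- The substitution recovers `H` at `Y = 0`; hence `aeval φ_q H ≠ 0` for `H ≠ 0`. [folklore] -/
theorem aeval_lineShift_ne_zero (H : MvPolynomial (Fin (t + 1)) ℂ) (hH : H ≠ 0) (q : Fin t → ℂ) :
    (aeval (Fin.cons (Polynomial.C (X 0))
        (fun i => Polynomial.C (X i.succ) + Polynomial.C (C (q i)) * Polynomial.X) :
        Fin (t + 1) → Polynomial (MvPolynomial (Fin (t + 1)) ℂ)) H) ≠ 0 := by
  intro h0
  apply hH
  apply MvPolynomial.funext
  intro z
  rw [map_zero]
  have h := eval_cons_add_smul H q (z 0) (Fin.tail z) 0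
  rw [zero_smul, add_zero, Fin.cons_self_tail, h0, Polynomial.map_zero, Polynomial.eval_zero] at h
  exact h

end Shift

/-! ## Part B. THEOREM L₀ / L -/

section Dominance

variable {t : ℕ}

/-- A polynomial in `y` with a leading coefficient of norm `≥ γ > 0` and lower coefficients of norm
`≤ B` (`B ≥ 0`) does not vanish for `‖y‖ ≥ 1`, `‖y‖ > 2 d B / γ` (`d` = the degree bound).
[folklore] -/
theorem sum_range_succ_mul_pow_ne_zero {d : ℕ} (a : ℕ → ℂ) {γ B : ℝ} (hB : 0 ≤ B)
    (hlead : γ ≤ ‖a d‖) (hlow : ∀ k < d, ‖a k‖ ≤ B) {y : ℂ} (hy1 : 1 ≤ ‖y‖)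
    (hy : 2 * d * B < γ * ‖y‖) : ∑ k ∈ range (d + 1), a k * y ^ k ≠ 0 := by
  rw [Finset.sum_range_succ]
  intro h0
  have hyd : 0 < ‖y‖ ^ d := pow_pos (by linarith) d
  -- `‖y‖ · ‖lower part‖ ≤ d B ‖y‖^d`
  have hlowsum : ‖y‖ * ‖∑ k ∈ range d, a k * y ^ k‖ ≤ d * B * ‖y‖ ^ d := by
    have h1 : ‖∑ k ∈ range d, a k * y ^ k‖ ≤ ∑ k ∈ range d, B * ‖y‖ ^ k := by
      refine (norm_sum_le _ _).trans (Finset.sum_le_sum fun k hk => ?_)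
      rw [norm_mul, norm_pow]
      exact mul_le_mul_of_nonneg_right (hlow k (Finset.mem_range.1 hk)) (pow_nonneg (norm_nonneg _) _)
    have h2 : ∀ k ∈ range d, ‖y‖ * (B * ‖y‖ ^ k) ≤ B * ‖y‖ ^ d := by
      intro k hk
      have hk' : k + 1 ≤ d := Finset.mem_range.1 hk
      have hpow : ‖y‖ ^ (k + 1) ≤ ‖y‖ ^ d := pow_le_pow_right₀ hy1 hk'
      rw [pow_succ] at hpow
      nlinarith
    calc ‖y‖ * ‖∑ k ∈ range d, a k * y ^ k‖ ≤ ‖y‖ * ∑ k ∈ range d, B * ‖y‖ ^ k :=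
          mul_le_mul_of_nonneg_left h1 (norm_nonneg _)
      _ = ∑ k ∈ range d, ‖y‖ * (B * ‖y‖ ^ k) := by rw [Finset.mul_sum]
      _ ≤ ∑ k ∈ range d, B * ‖y‖ ^ d := Finset.sum_le_sum h2
      _ = d * B * ‖y‖ ^ d := by rw [Finset.sum_const, Finset.card_range, nsmul_eq_mul]; ring
  -- `‖y‖ · ‖top term‖ ≥ γ ‖y‖ ‖y‖^d`
  have htop : γ * ‖y‖ * ‖y‖ ^ d ≤ ‖y‖ * ‖a d * y ^ d‖ := by
    rw [norm_mul, norm_pow]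
    have := mul_le_mul_of_nonneg_right hlead hyd.le
    nlinarith [norm_nonneg y]
  have heq : a d * y ^ d = -∑ k ∈ range d, a k * y ^ k := by linear_combination h0
  rw [heq, norm_neg] at htop
  have h1 : γ * ‖y‖ * ‖y‖ ^ d ≤ d * B * ‖y‖ ^ d := htop.trans hlowsum
  have hd0 : (0 : ℝ) ≤ d := Nat.cast_nonneg d
  have h2 : (d : ℝ) * B ≤ 2 * d * B := by nlinarith
  have h3 : 0 < (γ * ‖y‖ - d * B) * ‖y‖ ^ d := mul_pos (by linarith) hyd
  nlinarith

/-- **THEOREM L₀ (one family).**  `H ∈ ℂ[W, X₁..X_t]`, direction `q ∈ ℂ^t`; if `w_m → w₀`,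
`r_m → r₀`, `‖y_m‖ → ∞` and the leading `Y`-coefficient of the line substitution `aeval φ_q H` does
not vanish at `(w₀, r₀)`, then `H(w_m, r_m + y_m q) ≠ 0` for all large `m`. (new) -/
theorem eventually_eval_ne_zero_of_transversal_limit (H : MvPolynomial (Fin (t + 1)) ℂ)
    (q : Fin t → ℂ) {w₀ : ℂ} {r₀ : Fin t → ℂ}
    (hlead : eval (Fin.cons w₀ r₀ : Fin (t + 1) → ℂ)
      (aeval (Fin.cons (Polynomial.C (X 0))
          (fun i => Polynomial.C (X i.succ) + Polynomial.C (C (q i)) * Polynomial.X) :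
          Fin (t + 1) → Polynomial (MvPolynomial (Fin (t + 1)) ℂ)) H).leadingCoeff ≠ 0)
    {w : ℕ → ℂ} {r : ℕ → Fin t → ℂ} {y : ℕ → ℂ}
    (hw : Tendsto w atTop (𝓝 w₀)) (hr : Tendsto r atTop (𝓝 r₀))
    (hy : Tendsto (fun m => ‖y m‖) atTop atTop) :
    ∀ᶠ m : ℕ in atTop, eval (Fin.cons (w m) (r m + y m • q) : Fin (t + 1) → ℂ) H ≠ 0 := by
  classical
  have hexpand : ∀ m, eval (Fin.cons (w m) (r m + y m • q) : Fin (t + 1) → ℂ) H = _ :=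
    fun m => eval_cons_add_smul H q (w m) (r m) (y m)
  generalize hHq : (aeval (Fin.cons (Polynomial.C (X 0))
      (fun i => Polynomial.C (X i.succ) + Polynomial.C (C (q i)) * Polynomial.X) :
      Fin (t + 1) → Polynomial (MvPolynomial (Fin (t + 1)) ℂ)) H) = Hq at hlead hexpand
  -- the coefficients along the sequence and their limits
  obtain ⟨a, ha⟩ : ∃ a : ℕ → ℕ → ℂ,
      a = fun m k => eval (Fin.cons (w m) (r m) : Fin (t + 1) → ℂ) (Hq.coeff k) := ⟨_, rfl⟩
  obtain ⟨aL, haL⟩ : ∃ aL : ℕ → ℂ,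
      aL = fun k => eval (Fin.cons w₀ r₀ : Fin (t + 1) → ℂ) (Hq.coeff k) := ⟨_, rfl⟩
  obtain ⟨d, hd⟩ : ∃ d : ℕ, d = Hq.natDegree := ⟨_, rfl⟩
  have hcons : Tendsto (fun m => (Fin.cons (w m) (r m) : Fin (t + 1) → ℂ)) atTop
      (𝓝 (Fin.cons w₀ r₀)) := hw.finCons hr
  have hak : ∀ k, Tendsto (fun m => a m k) atTop (𝓝 (aL k)) := fun k => by
    rw [ha, haL]
    exact ((MvPolynomial.continuous_eval (Hq.coeff k)).tendsto _).comp hcons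
  have haLd : aL d = eval (Fin.cons w₀ r₀ : Fin (t + 1) → ℂ) Hq.leadingCoeff := by
    rw [haL, hd]
    rfl
  obtain ⟨γ, hγ⟩ : ∃ γ : ℝ, γ = ‖aL d‖ := ⟨_, rfl⟩
  have hγ0 : 0 < γ := by rw [hγ, haLd]; exact norm_pos_iff.2 hlead
  obtain ⟨B, hB⟩ : ∃ B : ℝ, B = (∑ k ∈ range (d + 1), ‖aL k‖) + 1 := ⟨_, rfl⟩
  have hB0 : 0 ≤ B := by
    rw [hB]
    have := Finset.sum_nonneg fun k (_ : k ∈ range (d + 1)) => norm_nonneg (aL k)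
    linarith
  -- eventually: the top coefficient is large, the others bounded
  have hlead' : ∀ᶠ m : ℕ in atTop, γ / 2 ≤ ‖a m d‖ := by
    have h := (hak d).norm
    filter_upwards [h.eventually (lt_mem_nhds (show γ / 2 < ‖aL d‖ by rw [hγ]; linarith))]
      with m hm
    exact hm.le
  have hlow : ∀ᶠ m : ℕ in atTop, ∀ k < d, ‖a m k‖ ≤ B := by
    have h : ∀ k, ∀ᶠ m : ℕ in atTop, ‖a m k‖ ≤ B := by
      intro k
      by_cases hk : k ∈ range (d + 1)
      · have hle : ‖aL k‖ ≤ ∑ k ∈ range (d + 1), ‖aL k‖ :=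
          Finset.single_le_sum (f := fun k => ‖aL k‖) (fun _ _ => norm_nonneg _) hk
        filter_upwards [((hak k).norm).eventually
          (gt_mem_nhds (show ‖aL k‖ < ‖aL k‖ + 1 by linarith))] with m hm
        rw [hB]
        linarith [hm.le]
      · have hk' : Hq.natDegree < k := by
          rw [Finset.mem_range, not_lt] at hk; omega
        filter_upwards with m
        rw [ha]
        dsimp only
        rw [Polynomial.coeff_eq_zero_of_natDegree_lt hk', map_zero, norm_zero]
        exact hB0
    have hall := (Filter.eventually_all_finset (range d)).2 fun k _ => h k
    filter_upwards [hall] with m hm k hk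
    exact hm k (Finset.mem_range.2 hk)
  filter_upwards [hlead', hlow, hy.eventually_ge_atTop 1,
    hy.eventually_gt_atTop (2 * d * B / (γ / 2))] with m hml hmB hy1 hybig
  -- expand the evaluation as a polynomial in `y`
  rw [hexpand m]
  have hdeg : (Hq.map (eval (Fin.cons (w m) (r m) : Fin (t + 1) → ℂ))).natDegree < d + 1 := by
    rw [hd]
    exact (Polynomial.natDegree_map_le).trans_lt (Nat.lt_succ_self _)
  rw [Polynomial.eval_eq_sum_range' hdeg]
  simp only [Polynomial.coeff_map]
  have hml' : γ / 2 ≤ ‖a m d‖ := hml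
  have hmB' : ∀ k < d, ‖a m k‖ ≤ B := hmB
  rw [ha] at hml' hmB'
  refine sum_range_succ_mul_pow_ne_zero (fun k => eval (Fin.cons (w m) (r m) : Fin (t + 1) → ℂ)
    (Hq.coeff k)) hB0 hml' hmB' hy1 ?_
  have h := (div_lt_iff₀ (half_pos hγ0)).1 hybig
  linarith

/-- **THEOREM L (all families).**  Fix a direction `q ∈ ℂ^t` and a set `U ⊆ ℂ^{1+t}` of limits
on which no nonzero polynomial vanishes identically.  If for every `u = (w₀, r₀) ∈ U` there are
sequences `w_m → w₀`, `r_m → r₀`, `‖y_m‖ → ∞` with `H(w_m, r_m + y_m q) = 0` for all large `m`, then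
`H = 0`. (new) -/
theorem eq_zero_of_transversal_limits (H : MvPolynomial (Fin (t + 1)) ℂ) (q : Fin t → ℂ)
    {U : Set (Fin (t + 1) → ℂ)}
    (hU : ∀ G : MvPolynomial (Fin (t + 1)) ℂ, G ≠ 0 → ∃ u ∈ U, eval u G ≠ 0)
    (hseq : ∀ u ∈ U, ∃ (w : ℕ → ℂ) (r : ℕ → Fin t → ℂ) (y : ℕ → ℂ),
      Tendsto w atTop (𝓝 (u 0)) ∧ Tendsto r atTop (𝓝 (Fin.tail u)) ∧
      Tendsto (fun m => ‖y m‖) atTop atTop ∧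
      ∀ᶠ m : ℕ in atTop, eval (Fin.cons (w m) (r m + y m • q) : Fin (t + 1) → ℂ) H = 0) :
    H = 0 := by
  by_contra hH
  have hne := aeval_lineShift_ne_zero H hH q
  obtain ⟨u, huU, hu⟩ := hU _ (Polynomial.leadingCoeff_ne_zero.2 hne)
  obtain ⟨w, r, y, hw, hr, hy, hzero⟩ := hseq u huU
  have hu' : eval (Fin.cons (u 0) (Fin.tail u) : Fin (t + 1) → ℂ)
      (aeval (Fin.cons (Polynomial.C (X 0))
          (fun i => Polynomial.C (X i.succ) + Polynomial.C (C (q i)) * Polynomial.X) :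
          Fin (t + 1) → Polynomial (MvPolynomial (Fin (t + 1)) ℂ)) H).leadingCoeff ≠ 0 := by
    rwa [Fin.cons_self_tail]
  have hev := eventually_eval_ne_zero_of_transversal_limit H q hu' hw hr hy
  obtain ⟨m, hm1, hm2⟩ := (hev.and hzero).exists
  exact hm1 hm2

end Dominance

/-! ## Part C. Density form -/

section Density

variable {n t : ℕ}

/-- **THEOREM L (density from transversal limits).**  `S ⊆ ℂⁿ × ℂⁿ` irreducible closed of
dimension `≤ t + 1`, coordinates `c₁..c_t` and `β`, a direction `q ∈ ℂ^t`, and a set `U ⊆ ℂ^{1+t}`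
of limits supporting no nonzero polynomial.  If for every `u = (w₀, r₀) ∈ U` there are points `p_m`,
exponential points of `S` for large `m`, whose `c`-coordinates are `r_m + y_m q` with `r_m → r₀`,
`‖y_m‖ → ∞`, and whose `β`-coordinate tends to `w₀`, then `I(S ∩ Γ_exp) = I(S)`. (new) -/
theorem unprojectedDense_of_transversal_limits {S : Set (Fin n ⊕ Fin n → ℂ)}
    (hS : IsIrreducibleClosed ℂ S) (hdim : zariskiDim ℂ S ≤ ((t + 1 : ℕ) : WithBot ℕ∞))
    (c : Fin t → Fin n ⊕ Fin n) (β : Fin n ⊕ Fin n) (q : Fin t → ℂ)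
    {U : Set (Fin (t + 1) → ℂ)}
    (hU : ∀ G : MvPolynomial (Fin (t + 1)) ℂ, G ≠ 0 → ∃ u ∈ U, eval u G ≠ 0)
    (hpts : ∀ u ∈ U, ∃ (p : ℕ → Fin n ⊕ Fin n → ℂ) (r : ℕ → Fin t → ℂ) (y : ℕ → ℂ),
      (∀ᶠ m : ℕ in atTop, p m ∈ S ∧ p m ∈ expGraph ℂ n) ∧
      (∀ᶠ m : ℕ in atTop, (fun i => p m (c i)) = r m + y m • q) ∧
      Tendsto (fun m => p m β) atTop (𝓝 (u 0)) ∧ Tendsto r atTop (𝓝 (Fin.tail u)) ∧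
      Tendsto (fun m => ‖y m‖) atTop atTop) :
    UnprojectedDense S := by
  refine unprojectedDense_of_no_relation hS hdim (Fin.cons β c) fun H hH0 => ?_
  by_contra hcon
  push Not at hcon
  apply hH0
  refine eq_zero_of_transversal_limits H q hU fun u hu => ?_
  obtain ⟨p, r, y, hpS, hcoord, hβ, hr, hy⟩ := hpts u hu
  refine ⟨fun m => p m β, r, y, hβ, hr, hy, ?_⟩
  filter_upwards [hpS, hcoord] with m hm hmc
  rw [← hmc, ← comp_fin_cons]
  exact hcon (p m) hm

end Density

end Summit.Schanuel.Schanuel.Theorems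

end
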